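import Summits.FinalStateConjecture.FinalStateConjecture.Theorems.PhaseMixingCaptureCaptureSufficesTameNoC0GlueCurves
import HarnessLib

/-!
# `CaptureSufficesTame` (stmt-FinalStateConjecture-17270), line `only-the-third-law-is-generic`: glue stub
# `stub_noC0_glue` (oriented form), helper file 3 — the pulled-back relative causal future

For an oriented `ε`-isometry `Φ` (`ε ≤ 1/80`) of `Ω ⊇ Ω'` into Minkowski space with left inverse `G`, base point
`p₀ ∈ Ω'`, and `J` the flat causal future of `P = Φ p₀` inside `U = Φ '' Ω'`, this file derives the interface
properties of `C = Ω' ∩ Φ⁻¹(closure J)` and `O = Ω' ∩ Φ⁻¹(interior J)` consumed by the limit argument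
NoC0KerrChart (namespace `NoC0Glue`):

* `O` is open, `C` is relatively closed in `Ω'` (continuity of `Φ`);
* (H-D) `pushup` — a `Φ^*η`-timelike future path inside `Ω'` from `y ∈ C` to `z` puts `z` into `O` (its image is a
  flat timelike path inside `U`; brick F1 (i));
* (H-p) `base_mem_not_mem` — `p₀ ∈ C ∖ O` (brick F1 (ii) with `l₀ = 0`);
* (H-t) `base_time_le_of_mem`, `base_time_le` — `t* ≥ p₀⁰` on `C` (flat causal paths pull back to `Φ^*η`-causal
  future paths, along which `t*` increases: brick K3);
* (H-reach) `reach` — `C` is approximated by ends of `t*`-parametrised `Φ^*η`-causal paths from `p₀`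
  (pull back, extend affinely, reparametrise by `t*`);
* `stub_noC0_glueSets` — (H-t) as a closed statement (registered helper sub-goal).

References: B. O'Neill, *Semi-Riemannian geometry*, 1983, Ch. 14, Cor. 14.1 and Lemma 14.3; M. Dafermos,
I. Rodnianski, arXiv:0811.0354, §5.1 (`t*`); M. Visser, arXiv:0706.0622, (32)–(35).
-/

-- the doubled `FinalStateConjecture.FinalStateConjecture` path component trips dupNamespace (as in the skeleton)
set_option linter.dupNamespace false
set_option maxSynthPendingDepth 3

noncomputable section

open Set Filter Function Metric
open scoped Topology ContDiff

namespace Summit.FinalStateConjecture.FinalStateConjecture.Theorems.PhaseMixingCaptureCaptureSufficesTame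

open Literature.Geometry.Lorentzian

namespace NoC0Glue

/-! ## Two cone facts for a bilinear form -/

/-- Rescaling a causal vector keeps it causal: `B(kv, kv) = k² B(v, v) ≤ 0`. [folklore] -/
theorem smul_causal (B : E4 →L[ℝ] E4 →L[ℝ] ℝ) {v : E4} (hv : B v v ≤ 0) (k : ℝ) : B (k • v) (k • v) ≤ 0 := by
  simp only [map_smul, smul_apply, smul_eq_mul]
  nlinarith [mul_self_nonneg k]

/-- Normalising the time component: `((v⁰)⁻¹ v)⁰ = 1` for `v⁰ > 0`. [folklore] -/
theorem inv_smul_apply_zero {v : E4} (hv : 0 < v 0) : ((v 0)⁻¹ • v) 0 = 1 := by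
  simp [hv.ne']

/-! ## The pulled-back relative causal future `C = Ω' ∩ Φ⁻¹(closure J)`, `O = Ω' ∩ Φ⁻¹(interior J)` -/

section Sets

variable {M a ε : ℝ} {Ω Ω' : Set E4} {Φ G : E4 → E4} {p₀ : E4} {J : Set E4}

/-- `O = Ω' ∩ Φ⁻¹(interior J)` is open (`Φ` continuous on the open set `Ω'`). [folklore] -/
theorem isOpen_inter_preimage_interior (hΩ' : IsOpen Ω') (hcont : ContinuousOn Φ Ω') :
    IsOpen (Ω' ∩ Φ ⁻¹' interior J) :=
  hcont.isOpen_inter_preimage hΩ' isOpen_interior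

/-- `C = Ω' ∩ Φ⁻¹(closure J)` is relatively closed in `Ω'` (`Φ` continuous on `Ω'`). [folklore] -/
theorem mem_of_mem_closure_inter_preimage (hcont : ContinuousOn Φ Ω') {y : E4} (hy : y ∈ Ω')
    (hycl : y ∈ closure (Ω' ∩ Φ ⁻¹' closure J)) : y ∈ Ω' ∩ Φ ⁻¹' closure J := by
  refine ⟨hy, ?_⟩
  have h1 : ContinuousWithinAt Φ (Ω' ∩ Φ ⁻¹' closure J) y := (hcont y hy).mono inter_subset_left
  have h2 := h1.mem_closure_image hycl
  refine closure_minimal ?_ isClosed_closure h2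
  rintro _ ⟨z, hz, rfl⟩
  exact hz.2

/-- **(H-D) push-up in the chart.** If `y ∈ C`, `z ∈ Ω'`, and a path inside `Ω'` with `Φ^*η`-TIMELIKE future
velocities joins `y` to `z`, then `z ∈ O`: its image `Φ ∘ c` is a flat timelike path inside `U = Φ '' Ω'` from
`Φ y ∈ closure J` (orientation hypothesis `hO` for the time direction), and brick F1 (i) applies
(O'Neill 1983, Ch. 14, Cor. 14.1, transported through the chart). [cite: ONeill1983, Ch. 14, Cor. 14.1] -/
theorem pushup (hM : 0 ≤ M) (hΩ : IsOpen Ω) (hΩext : Ω ⊆ (Kerr.exterior M a : Set E4)) (hΦ : ContDiffOn ℝ ∞ Φ Ω)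
    (hε : ε ≤ 1 / 80)
    (hclose : ∀ y ∈ Ω, ‖MetricCoord.pullMetric (fun _ ↦ Minkowski.bilin) Φ y - Kerr.bilin M a y‖ ≤ ε)
    (hO : ∀ y ∈ Ω, ∀ v : E4, MetricCoord.pullMetric (fun _ ↦ Minkowski.bilin) Φ y v v ≤ 0 → 0 < v 0 →
      0 < (fderiv ℝ Φ y v) 0)
    (hΩ' : IsOpen Ω') (hΩ'Ω : Ω' ⊆ Ω) (hp₀ : p₀ ∈ Ω')
    (hJ : J = {Y | Y ∈ Φ '' Ω' ∧ (Y = Φ p₀ ∨ ∃ (γ : ℝ → E4) (a b : ℝ), a < b ∧ γ a = Φ p₀ ∧ γ b = Y ∧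
      ∀ t ∈ Set.Icc a b, γ t ∈ Φ '' Ω' ∧ ∃ v : E4, HasDerivAt γ v t ∧ Minkowski.bilin v v ≤ 0 ∧ 0 < v 0)})
    {y : E4} (hy : y ∈ Ω' ∩ Φ ⁻¹' closure J) {z : E4} (hz : z ∈ Ω')
    (hpath : ∃ (c : ℝ → E4) (s₁ s₂ : ℝ), s₁ < s₂ ∧ c s₁ = y ∧ c s₂ = z ∧
      ∀ t ∈ Icc s₁ s₂, c t ∈ Ω' ∧ ∃ v : E4, HasDerivAt c v t ∧
        MetricCoord.pullMetric (fun _ ↦ Minkowski.bilin) Φ (c t) v v < 0 ∧ 0 < v 0) :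
    z ∈ Ω' ∩ Φ ⁻¹' interior J := by
  obtain ⟨c, s₁, s₂, hs, rfl, rfl, hc⟩ := hpath
  have hU : IsOpen (Φ '' Ω') := isOpen_image hM hΩ hΩext hΦ (by linarith) hclose hΩ' hΩ'Ω
  obtain ⟨hF1, -⟩ := stub_noC0_flatBasics (Φ '' Ω') hU (Φ p₀) ⟨p₀, hp₀, rfl⟩ J hJ
  refine ⟨hz, hF1 (Φ (c s₁)) (Φ (c s₂)) ⟨_, hy.1, rfl⟩ ⟨_, hz, rfl⟩ hy.2
    ⟨Φ ∘ c, s₁, s₂, hs, rfl, rfl, fun t ht ↦ ?_⟩⟩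
  obtain ⟨hct, v, hv, hvv, hv0⟩ := hc t ht
  obtain ⟨hd, hη⟩ := hasDerivAt_comp hΩ hΦ hv (hΩ'Ω hct)
  exact ⟨⟨c t, hct, rfl⟩, _, hd, by rw [hη]; exact hvv, hO (c t) (hΩ'Ω hct) v hvv.le hv0⟩

/-- **(H-p) the base point is a boundary point**: `p₀ ∈ C` (`Φ p₀ ∈ J`) and `p₀ ∉ O` (`Φ p₀ ∉ interior J` by
brick F1 (ii) with the null direction `∂₀ + ∂₁` and `l₀ = 0`; O'Neill 1983, Ch. 14, Lemma 14.3).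
[cite: ONeill1983, Ch. 14, Lemma 14.3] -/
theorem base_mem_not_mem (hM : 0 ≤ M) (hΩ : IsOpen Ω) (hΩext : Ω ⊆ (Kerr.exterior M a : Set E4))
    (hΦ : ContDiffOn ℝ ∞ Φ Ω) (hε : ε ≤ 1 / 80)
    (hclose : ∀ y ∈ Ω, ‖MetricCoord.pullMetric (fun _ ↦ Minkowski.bilin) Φ y - Kerr.bilin M a y‖ ≤ ε)
    (hΩ' : IsOpen Ω') (hΩ'Ω : Ω' ⊆ Ω) (hp₀ : p₀ ∈ Ω')
    (hJ : J = {Y | Y ∈ Φ '' Ω' ∧ (Y = Φ p₀ ∨ ∃ (γ : ℝ → E4) (a b : ℝ), a < b ∧ γ a = Φ p₀ ∧ γ b = Y ∧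
      ∀ t ∈ Set.Icc a b, γ t ∈ Φ '' Ω' ∧ ∃ v : E4, HasDerivAt γ v t ∧ Minkowski.bilin v v ≤ 0 ∧ 0 < v 0)}) :
    p₀ ∈ Ω' ∩ Φ ⁻¹' closure J ∧ p₀ ∉ Ω' ∩ Φ ⁻¹' interior J := by
  have hU : IsOpen (Φ '' Ω') := isOpen_image hM hΩ hΩext hΦ (by linarith) hclose hΩ' hΩ'Ω
  obtain ⟨-, hF2⟩ := stub_noC0_flatBasics (Φ '' Ω') hU (Φ p₀) ⟨p₀, hp₀, rfl⟩ J hJ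
  have hPJ : Φ p₀ ∈ J := by
    rw [hJ]
    exact ⟨⟨p₀, hp₀, rfl⟩, Or.inl rfl⟩
  refine ⟨⟨hp₀, subset_closure hPJ⟩, fun h ↦ ?_⟩
  set d : E4 := E4.basisVector 0 + E4.basisVector 1 with hd_def
  have hd : Minkowski.bilin d d = 0 := by
    rw [hd_def, Minkowski.bilin_apply, Fin.sum_univ_three]
    simp
  have hd0 : 0 < d 0 := by simp [hd_def]
  have hseg : ∀ s ∈ Set.Icc (0 : ℝ) 0, Φ p₀ + s • d ∈ Φ '' Ω' := by
    intro s hs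
    have hs0 : s = 0 := le_antisymm hs.2 hs.1
    rw [hs0, zero_smul, add_zero]
    exact ⟨p₀, hp₀, rfl⟩
  have key := (hF2 d hd hd0 0 le_rfl hseg 0 (left_mem_Icc.2 le_rfl)).2
  rw [zero_smul, add_zero] at key
  exact key h.2

/-- **(H-t) on `J`**: a point `Y ∈ J` pulls back to `G Y ∈ Ω'` with `p₀⁰ ≤ (G Y)⁰` — the defining flat causal path
pulls back to a `Φ^*η`-causal future path inside `Ω'` from `p₀`, along which `t*` strictly increases (brick K3
with the cone field `Φ^*η`, `‖Φ^*η − g_{M,a}‖ ≤ 1/80 ≤ 1/4`). Dafermos–Rodnianski arXiv:0811.0354, §5.1 (`t*` is a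
time function); Visser arXiv:0706.0622, (32)–(35). [cite: arXiv07060622, (32)–(35)] -/
theorem base_time_le_of_mem (hM : 0 ≤ M) (hΩ : IsOpen Ω) (hΩext : Ω ⊆ (Kerr.exterior M a : Set E4))
    (hΦ : ContDiffOn ℝ ∞ Φ Ω) (hε : ε ≤ 1 / 80)
    (hclose : ∀ y ∈ Ω, ‖MetricCoord.pullMetric (fun _ ↦ Minkowski.bilin) Φ y - Kerr.bilin M a y‖ ≤ ε)
    (hO : ∀ y ∈ Ω, ∀ v : E4, MetricCoord.pullMetric (fun _ ↦ Minkowski.bilin) Φ y v v ≤ 0 → 0 < v 0 →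
      0 < (fderiv ℝ Φ y v) 0)
    (hG : ∀ y ∈ Ω, G (Φ y) = y) (hΩ'Ω : Ω' ⊆ Ω) (hp₀ : p₀ ∈ Ω')
    (hJ : J = {Y | Y ∈ Φ '' Ω' ∧ (Y = Φ p₀ ∨ ∃ (γ : ℝ → E4) (a b : ℝ), a < b ∧ γ a = Φ p₀ ∧ γ b = Y ∧
      ∀ t ∈ Set.Icc a b, γ t ∈ Φ '' Ω' ∧ ∃ v : E4, HasDerivAt γ v t ∧ Minkowski.bilin v v ≤ 0 ∧ 0 < v 0)})
    {Y : E4} (hY : Y ∈ J) : G Y ∈ Ω' ∧ p₀ 0 ≤ G Y 0 := by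
  rw [hJ] at hY
  obtain ⟨⟨y', hy', rfl⟩, hP | ⟨γ, s₁, s₂, h12, hγ1, hγ2, hγ⟩⟩ := hY
  · rw [hG y' (hΩ'Ω hy')]
    have : y' = p₀ := by rw [← hG y' (hΩ'Ω hy'), hP, hG p₀ (hΩ'Ω hp₀)]
    exact ⟨hy', by rw [this]⟩
  · have hpull := pullback_causalPath hM hΩ hΩext hΦ hε hclose hO hG hΩ'Ω hγ
    have hK := (kerr_time_strictMonoOn_and_norm_sub_le M a
      (fun t ↦ MetricCoord.pullMetric (fun _ ↦ Minkowski.bilin) Φ ((G ∘ γ) t)) (G ∘ γ) s₁ s₂ hM h12.le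
      (fun t ht ↦ ⟨(hpull t ht).2.1, (hpull t ht).2.2⟩)).1
    have hlt := hK (left_mem_Icc.2 h12.le) (right_mem_Icc.2 h12.le) h12
    simp only [comp_apply, hγ1, hγ2, hG p₀ (hΩ'Ω hp₀)] at hlt
    rw [hG y' (hΩ'Ω hy')] at hlt ⊢
    exact ⟨hy', hlt.le⟩

/-- **(H-t)**: `p₀⁰ ≤ y⁰` for every `y ∈ C = Ω' ∩ Φ⁻¹(closure J)` (from the `J`-version by continuity of the
inverse chart `G` at `Φ y`). Dafermos–Rodnianski arXiv:0811.0354, §5.1. [cite: arXiv07060622, (32)–(35)] -/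
theorem base_time_le (hM : 0 ≤ M) (hΩ : IsOpen Ω) (hΩext : Ω ⊆ (Kerr.exterior M a : Set E4))
    (hΦ : ContDiffOn ℝ ∞ Φ Ω) (hε : ε ≤ 1 / 80)
    (hclose : ∀ y ∈ Ω, ‖MetricCoord.pullMetric (fun _ ↦ Minkowski.bilin) Φ y - Kerr.bilin M a y‖ ≤ ε)
    (hO : ∀ y ∈ Ω, ∀ v : E4, MetricCoord.pullMetric (fun _ ↦ Minkowski.bilin) Φ y v v ≤ 0 → 0 < v 0 →
      0 < (fderiv ℝ Φ y v) 0)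
    (hG : ∀ y ∈ Ω, G (Φ y) = y) (hΩ'Ω : Ω' ⊆ Ω) (hp₀ : p₀ ∈ Ω')
    (hJ : J = {Y | Y ∈ Φ '' Ω' ∧ (Y = Φ p₀ ∨ ∃ (γ : ℝ → E4) (a b : ℝ), a < b ∧ γ a = Φ p₀ ∧ γ b = Y ∧
      ∀ t ∈ Set.Icc a b, γ t ∈ Φ '' Ω' ∧ ∃ v : E4, HasDerivAt γ v t ∧ Minkowski.bilin v v ≤ 0 ∧ 0 < v 0)})
    {y : E4} (hy : y ∈ Ω' ∩ Φ ⁻¹' closure J) : p₀ 0 ≤ y 0 := by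
  obtain ⟨Yk, hYk, hlim⟩ := mem_closure_iff_seq_limit.1 hy.2
  have hGc : ContinuousAt G (Φ y) := continuousAt_inverse hM hΩ hΩext hΦ (by linarith) hclose hG (hΩ'Ω hy.1)
  have h1 : Tendsto (fun k ↦ G (Yk k) 0) atTop (𝓝 (y 0)) := by
    have h := hGc.tendsto.comp hlim
    rw [hG y (hΩ'Ω hy.1)] at h
    exact (NoC0Flat.continuous_apply_zero.tendsto y).comp h
  exact ge_of_tendsto' h1 fun k ↦ (base_time_le_of_mem hM hΩ hΩext hΦ hε hclose hO hG hΩ'Ω hp₀ hJ (hYk k)).2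

/-- **(H-reach)**: every `y ∈ C` is approximated by points `y' ∈ Ω'` that are `p₀` or are reached from `p₀` by a
`t*`-PARAMETRISED `Φ^*η`-causal differentiable path inside `Ω'` (`(c t)⁰ = t`, `c'⁰ = 1`): pick `Y' ∈ J` near
`Φ y` (continuity of `G`), pull its flat causal path back to `Ω'`, extend it affinely beyond the endpoints and
reparametrise by `t*` (`reparam`). [folklore] -/
theorem reach (hM : 0 ≤ M) (hΩ : IsOpen Ω) (hΩext : Ω ⊆ (Kerr.exterior M a : Set E4))
    (hΦ : ContDiffOn ℝ ∞ Φ Ω) (hε : ε ≤ 1 / 80)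
    (hclose : ∀ y ∈ Ω, ‖MetricCoord.pullMetric (fun _ ↦ Minkowski.bilin) Φ y - Kerr.bilin M a y‖ ≤ ε)
    (hO : ∀ y ∈ Ω, ∀ v : E4, MetricCoord.pullMetric (fun _ ↦ Minkowski.bilin) Φ y v v ≤ 0 → 0 < v 0 →
      0 < (fderiv ℝ Φ y v) 0)
    (hG : ∀ y ∈ Ω, G (Φ y) = y) (hΩ'Ω : Ω' ⊆ Ω) (hp₀ : p₀ ∈ Ω')
    (hJ : J = {Y | Y ∈ Φ '' Ω' ∧ (Y = Φ p₀ ∨ ∃ (γ : ℝ → E4) (a b : ℝ), a < b ∧ γ a = Φ p₀ ∧ γ b = Y ∧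
      ∀ t ∈ Set.Icc a b, γ t ∈ Φ '' Ω' ∧ ∃ v : E4, HasDerivAt γ v t ∧ Minkowski.bilin v v ≤ 0 ∧ 0 < v 0)})
    {y : E4} (hy : y ∈ Ω' ∩ Φ ⁻¹' closure J) {δ : ℝ} (hδ : 0 < δ) :
    ∃ y' ∈ Ω', ‖y' - y‖ < δ ∧ (y' = p₀ ∨ ∃ c : ℝ → E4, c (p₀ 0) = p₀ ∧
      c (y' 0) = y' ∧ p₀ 0 < y' 0 ∧ ∀ t ∈ Icc (p₀ 0) (y' 0), c t ∈ Ω' ∧ c t 0 = t ∧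
        ∃ v : E4, HasDerivAt c v t ∧ MetricCoord.pullMetric (fun _ ↦ Minkowski.bilin) Φ (c t) v v ≤ 0 ∧
          v 0 = 1) := by
  have hGc : ContinuousAt G (Φ y) := continuousAt_inverse hM hΩ hΩext hΦ (by linarith) hclose hG (hΩ'Ω hy.1)
  have hnhds : G ⁻¹' ball y δ ∈ 𝓝 (Φ y) := by
    apply hGc.preimage_mem_nhds
    rw [hG y (hΩ'Ω hy.1)]
    exact ball_mem_nhds y hδ
  obtain ⟨Y', hY'n, hY'J⟩ := mem_closure_iff_nhds.1 hy.2 _ hnhds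
  have hY'Ω := (base_time_le_of_mem hM hΩ hΩext hΦ hε hclose hO hG hΩ'Ω hp₀ hJ hY'J).1
  refine ⟨G Y', hY'Ω, by rw [← dist_eq_norm]; exact hY'n, ?_⟩
  rw [hJ] at hY'J
  obtain ⟨⟨y'', hy'', hY'eq⟩, hP | ⟨γ, s₁, s₂, h12, hγ1, hγ2, hγ⟩⟩ := hY'J
  · left
    rw [hP, hG p₀ (hΩ'Ω hp₀)]
  · right
    have hpull := pullback_causalPath hM hΩ hΩext hΦ hε hclose hO hG hΩ'Ω hγ
    choose! V hV hBV hV0 using fun t ht ↦ (hpull t ht).2.2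
    obtain ⟨ĉ, hĉeq, hĉd⟩ := exists_extension h12 hV
    have hclamp : ∀ s, max s₁ (min s s₂) ∈ Icc s₁ s₂ := fun s ↦
      ⟨le_max_left _ _, max_le h12.le (min_le_right _ _)⟩
    obtain ⟨hmono, φ, hφf, -, hφ⟩ := reparam isOpen_univ ordConnected_univ (c := ĉ)
      (fun s _ ↦ ⟨_, hĉd s, hV0 _ (hclamp s)⟩)
    have hĉa : ĉ s₁ = p₀ := by
      rw [hĉeq s₁ (left_mem_Icc.2 h12.le)]
      show G (γ s₁) = p₀
      rw [hγ1, hG p₀ (hΩ'Ω hp₀)]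
    have hĉb : ĉ s₂ = G Y' := by
      rw [hĉeq s₂ (right_mem_Icc.2 h12.le)]
      show G (γ s₂) = G Y'
      rw [hγ2]
    have hcontf : ContinuousOn (fun s ↦ ĉ s 0) (Icc s₁ s₂) := fun s _ ↦
      (hasDerivAt_timeCoord (hĉd s)).continuousAt.continuousWithinAt
    refine ⟨ĉ ∘ φ, ?_, ?_, ?_, fun t ht ↦ ?_⟩
    · show ĉ (φ (p₀ 0)) = p₀
      rw [← hĉa, hφf s₁ (mem_univ s₁)]
    · show ĉ (φ (G Y' 0)) = G Y'
      rw [← hĉb, hφf s₂ (mem_univ s₂)]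
    · have h := hmono (mem_univ s₁) (mem_univ s₂) h12
      simp only [hĉa, hĉb] at h
      exact h
    · rw [← hĉa, ← hĉb] at ht
      obtain ⟨s, hs, hst⟩ : ∃ s ∈ Icc s₁ s₂, ĉ s 0 = t := intermediate_value_Icc h12.le hcontf ht
      obtain ⟨-, hft, v, hvd, hd⟩ := hφ t ⟨s, mem_univ _, hst⟩
      have hφs : φ t = s := by rw [← hst, hφf s (mem_univ _)]
      have hclamps : max s₁ (min s s₂) = s := by rw [min_eq_left hs.2, max_eq_right hs.1]
      have hv_eq : v = V s := by
        rw [hφs] at hvd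
        have h := hvd.unique (hĉd s)
        rwa [hclamps] at h
      have hpos : (ĉ ∘ φ) t = (G ∘ γ) s := by
        show ĉ (φ t) = _
        rw [hφs, hĉeq s hs]
      refine ⟨?_, hft, _, hd, ?_, inv_smul_apply_zero (by rw [hv_eq]; exact hV0 s hs)⟩
      · rw [hpos]
        exact (hpull s hs).1
      · rw [hpos, hv_eq]
        exact smul_causal _ (hBV s hs) _

end Sets

end NoC0Glue

open NoC0Glue in
/-- **(H-t) as a closed statement (registered helper sub-goal `stub_noC0_glueSets` of the glue stub).** For an
oriented `ε`-isometry `Φ` (`ε ≤ 1/80`, injective and `C^∞` on the open `Ω ⊆` Kerr exterior, `0 ≤ M`) and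
`p₀ ∈ Ω' ⊆ Ω`: every point `y ∈ Ω'` whose image lies in the closure of the flat causal future `J` of `Φ p₀` inside
`Φ '' Ω'` satisfies `p₀⁰ ≤ y⁰` (`t*` is a time function for the pulled-back cones; Dafermos–Rodnianski
arXiv:0811.0354, §5.1; Visser arXiv:0706.0622, (32)–(35)). [cite: arXiv07060622, (32)–(35)] -/
theorem stub_noC0_glueSets :
    ∀ (M a : ℝ) (Ω Ω' : Set E4) (Φ : E4 → E4) (ε : ℝ) (p₀ : E4), 0 ≤ M → IsOpen Ω →
      Ω ⊆ (Kerr.exterior M a : Set E4) → Ω' ⊆ Ω → p₀ ∈ Ω' → ContDiffOn ℝ ∞ Φ Ω → InjOn Φ Ω → ε ≤ 1 / 80 →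
      (∀ y ∈ Ω, ‖MetricCoord.pullMetric (fun _ ↦ Minkowski.bilin) Φ y - Kerr.bilin M a y‖ ≤ ε) →
      (∀ y ∈ Ω, ∀ v : E4, MetricCoord.pullMetric (fun _ ↦ Minkowski.bilin) Φ y v v ≤ 0 → 0 < v 0 →
        0 < (fderiv ℝ Φ y v) 0) →
      ∀ J : Set E4,
        J = {Y | Y ∈ Φ '' Ω' ∧ (Y = Φ p₀ ∨ ∃ (γ : ℝ → E4) (a b : ℝ), a < b ∧ γ a = Φ p₀ ∧ γ b = Y ∧
              ∀ t ∈ Set.Icc a b, γ t ∈ Φ '' Ω' ∧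
                ∃ v : E4, HasDerivAt γ v t ∧ Minkowski.bilin v v ≤ 0 ∧ 0 < v 0)} →
      ∀ y ∈ Ω' ∩ Φ ⁻¹' closure J, p₀ 0 ≤ y 0 := by
  intro M a Ω Ω' Φ ε p₀ hM hΩ hΩext hΩ'Ω hp₀ hΦ hinj hε hclose hO J hJ y hy
  have hG : ∀ y ∈ Ω, invFunOn Φ Ω (Φ y) = y := fun y hy ↦ hinj.leftInvOn_invFunOn hy
  exact base_time_le hM hΩ hΩext hΦ hε hclose hO hG hΩ'Ω hp₀ hJ hy

end Summit.FinalStateConjecture.FinalStateConjecture.Theorems.PhaseMixingCaptureCaptureSufficesTame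

end
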